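import Literature.AnabelianGeometry.SemiGraphs.FiniteEtaleCoveringCompLocalOfTie
import Literature.AnabelianGeometry.SemiGraphs.TieLocalWitness
import Literature.AnabelianGeometry.SemiGraphs.TieBijective
import Literature.AnabelianGeometry.SemiGraphs.TieLabels
import Literature.AnabelianGeometry.SemiGraphs.EdgeSectionMonoAnyEdge
import Literature.AnabelianGeometry.SemiGraphs.VertexAlignedSectionMono
import Literature.AnabelianGeometry.SemiGraphs.FiniteEtaleCoveringCompAssembly
import Literature.AnabelianGeometry.SemiGraphs.BranchAlignedComp
import Literature.AnabelianGeometry.SemiGraphs.FiniteEtaleCoveringOfIso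

/-!
# Finite étale coverings (print's sense) of CONNECTED semi-graphs of anabelioids compose
# ([SemiAnbd] Def. 2.2 (i) p. 23, Rmk. 2.4.1 / 2.4.2 p. 26)

Mochizuki, *Semi-graphs of anabelioids*, Publ. RIMS **42** (2006) 221–322, §2, Def. 2.2 (i) p. 23 and
Remark 2.4.1 p. 26 (whose universally sub-coverticial clause uses: the composite of finite étale coverings
is a finite étale covering) [cite: MochizukiSemiAnbd2006, Rem. 2.4.1 p.26].

PROOF-ONLY (abc-iut cell, layer L3; FACT-LIST row F-1478 `remark_2_4_1_covering`, residual (L) «the LOCAL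
clause of a composite of print's coverings»; Route W closing assembly, seat abc-iut-w5-d041).  The inputs
of `Hom.IsFiniteEtaleCoveringOf.comp_of_tie` (`FiniteEtaleCoveringCompLocalOfTie`) are discharged BY NAME:
the section maps are monomorphisms by abc-iut-w4-d079's `IsVertexAligned.localGlobalSection_mono` and
`Hom.sectionMapE_mono` (every edge); the tie by abc-iut-f-161's `Hom.tie_bijective` with
`Hom.localGlobalSection_factors` / `Hom.nonempty_isoE_of_sectionMapE`.  Results:

* `Hom.IsFiniteEtaleCoveringOf.comp_of_connected` — for `φ : 𝒢 → ℋ` locally the covering of `B`, and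
  `ψ : ℋ → 𝒦` locally the covering of `A`, branch- and vertex-aligned, with a global witness `(αψ, e_ψ)`,
  `ℋ` and `𝒦` CONNECTED: `φ.comp ψ` is locally the covering of `(αψ⁻¹ B).left`;
* `Hom.IsFiniteEtaleCoveringGlobal.comp_of_connected` — **print's finite étale coverings of connected
  semi-graphs of anabelioids compose** (all four clauses: local here, global abc-iut-f-161
  `IsGlobalCoveringOf.comp_explicit`, vertex alignment abc-iut-f-160, branch alignment abc-iut-w5-d177).

Honest framing: the tie (`Hom.tie_bijective`) carries the hypotheses «middle and base graph connected»;
`remark_2_4_1_covering` (F-1478) as typed quantifies over ALL semi-graphs of anabelioids, so this file does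
NOT close F-1478 — the disconnected case (component-wise matching of `B(ℋ) ≃ B(𝒦)_{/A}`) is the residual.
Nothing here takes a side on [IUTchIII] Cor. 3.12; typed ≠ proved.
-/

namespace Literature.AnabelianGeometry.SemiGraphs

namespace SemiGraphOfAnabelioids

open CategoryTheory CategoryTheory.Limits CategoryTheory.PreGaloisCategory
open Literature.AnabelianGeometry.Anabelioids

universe v₁ u₁ u

-- Mathlib's `Over.pullback` / `Over.post` simp lemmas only fire under the pre-v4.2x defeq transparency
-- behaviour, exactly as in `Mathlib/CategoryTheory/Comma/Over/Pullback.lean` (also: `π₀Obj` coercions).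
set_option backward.isDefEq.respectTransparency false

variable {𝒢 ℋ 𝒦 : SemiGraphOfAnabelioids.{v₁, u₁, u}}

/-- **The LOCAL clause of a composite, for connected middle and base graphs** ([SemiAnbd] Def. 2.2 (i)
under Rmk. 2.4.2): `φ.comp ψ` is, locally, the finite étale covering attached to `(αψ⁻¹ B).left`.
[cite: MochizukiSemiAnbd2006, Def. 2.2(i) p.23] -/
theorem Hom.IsFiniteEtaleCoveringOf.comp_of_connected {φ : Hom 𝒢 ℋ} {ψ : Hom ℋ 𝒦} {B : ℋ.BObj}
    {A : 𝒦.BObj} (hφ : φ.IsFiniteEtaleCoveringOf B) (hψ : ψ.IsFiniteEtaleCoveringOf A)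
    (hal : ψ.IsBranchAligned) (hva : ψ.IsVertexAligned) (hℋ : ℋ.IsConnected) (h𝒦 : 𝒦.IsConnected)
    [HasBinaryProducts 𝒦.BObj] (αψ : Over A ⥤ ℋ.BObj) [αψ.IsEquivalence]
    (eψ : ψ.pullbackFunctor ≅ Over.star A ⋙ αψ) :
    (φ.comp ψ).IsFiniteEtaleCoveringOf (αψ.inv.obj B).left := by
  have hφ' : φ.IsFiniteEtaleCoveringOf (αψ.obj (αψ.inv.obj B)) :=
    hφ.congr_iso (αψ.asEquivalence.counitIso.app B).symm
  -- the local data of `ψ` (edge data at every presentation of the image edge)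
  obtain ⟨hψp, cV, cE₀, -, -, hVψ, hEψ, -⟩ := (show _ from hψ)
  choose αV hαV eV using hVψ
  have hE' : ∀ (e' : ℋ.graph.Edge) (f₀ : 𝒦.graph.Edge) (p : ψ.base.edgeMap e' = f₀),
      ∃ (Q : π₀Obj (A.T f₀)) (α : Over (Q.1 : 𝒦.E f₀) ⥤ ℋ.E e'),
        α.IsEquivalence ∧ Nonempty ((ψ.φE e' f₀ p).pullback ≅ Over.star (Q.1 : 𝒦.E f₀) ⋙ α) := by
    intro e' f₀ p; subst p; exact ⟨cE₀ e', hEψ e'⟩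
  choose cE αE hαE eE using hE'
  haveI : ∀ w, (αV w).IsEquivalence := hαV
  haveI : ∀ e' f₀ p, (αE e' f₀ p).IsEquivalence := hαE
  haveI : ∀ w, PreGaloisCategory.IsConnected ((cV w).1 : 𝒦.V (ψ.base.vertexMap w)) := fun w => (cV w).2
  haveI : ∀ e' f₀ p, PreGaloisCategory.IsConnected ((cE e' f₀ p).1 : 𝒦.E f₀) :=
    fun e' f₀ p => (cE e' f₀ p).2
  -- terminality of `K_{e′}(𝟙_A)`
  have hT : ∀ e' f₀ p, IsTerminal ((αψ ⋙ ℋ.ρE e' ⋙ (αE e' f₀ p).inv).obj (Over.mk (𝟙 A))) :=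
    fun e' f₀ p => by
      obtain ⟨-, -, hρE⟩ := ℋ.hasLimitsOfShape_bObj (J := Discrete PEmpty.{1})
      haveI := hρE e'
      haveI : PreservesLimitsOfShape (Discrete PEmpty.{1}) (αψ ⋙ ℋ.ρE e' ⋙ (αE e' f₀ p).inv) :=
        inferInstance
      exact Over.mkIdTerminal.isTerminalObj _ _
  -- the tie
  obtain ⟨O, OE, hO, hOE, hOc, hOEc, -⟩ := Hom.tie_bijective ψ A αψ eψ hψ hal hva hℋ h𝒦
  refine Hom.IsFiniteEtaleCoveringOf.comp_of_tie αψ eψ (αψ.inv.obj B) hψp cV αV (fun w => (eV w).some)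
    cE αE (fun e' f₀ p => (eE e' f₀ p).some) hT
    (fun e' f₀ p => Functor.isoWhiskerRight eψ.symm (ℋ.ρE e' ⋙ (αE e' f₀ p).inv) ≪≫
        Functor.isoWhiskerRight (ψ.reindexIso e' (ψ.base.edgeMap e') f₀ rfl p) (αE e' f₀ p).inv ≪≫
        Functor.isoWhiskerLeft (𝒦.ρE f₀) (Functor.isoWhiskerRight (eE e' f₀ p).some (αE e' f₀ p).inv) ≪≫
        Functor.isoWhiskerLeft (𝒦.ρE f₀ ⋙ Over.star ((cE e' f₀ p).1 : 𝒦.E f₀))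
          (αE e' f₀ p).asEquivalence.unitIso.symm)
    (fun _ _ _ => rfl) ?_ ?_ O ?_ hO OE ?_ hOE hφ'
  · -- vertex section maps are monomorphisms (abc-iut-w4-d079)
    intro w
    exact Hom.IsVertexAligned.localGlobalSection_mono ψ A αψ eψ w _ (αV w) (eV w).some hva (cV w).1.arrow
  · -- edge section maps are monomorphisms (abc-iut-w4-d079, every edge)
    intro e' f₀ p
    exact Hom.sectionMapE_mono ψ A αψ eψ hψ hal hva e' f₀ p (cE e' f₀ p).1.arrow (αE e' f₀ p)
      (eE e' f₀ p).some (hT e' f₀ p)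
  · -- the vertex section maps factor through the tie labels (abc-iut-f-161)
    intro w
    exact Hom.localGlobalSection_factors ψ A αψ eψ w _ (αV w) (eV w).some (O w) ((hOc w (O w)).mp rfl)
  · -- the edge section maps factor through the tie labels (abc-iut-f-161)
    intro e'
    obtain ⟨k, hk⟩ := Hom.nonempty_isoE_of_sectionMapE ψ A αψ eψ hψ hal hva e' _ (cE e' _ rfl).1.arrow
      (αE e' _ rfl) (eE e' _ rfl).some (hT e' _ rfl) (OE e') ((hOEc e' (OE e')).mp rfl)
    exact ⟨k.hom, hk⟩

/-- **Print's finite étale coverings of connected semi-graphs of anabelioids compose** ([SemiAnbd]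
Def. 2.2 (i), Rmk. 2.4.1 / 2.4.2): if `ψ : 𝒢″ → 𝒢′` and `φ : 𝒢′ → 𝒢` are finite étale coverings in
print's sense (local ∧ global ∧ branch-aligned ∧ vertex-aligned) and `𝒢′`, `𝒢` are connected, so is
`ψ.comp φ`. [cite: MochizukiSemiAnbd2006, Rem. 2.4.1 p.26] -/
theorem Hom.IsFiniteEtaleCoveringGlobal.comp_of_connected {𝒢 𝒢' 𝒢'' : SemiGraphOfAnabelioids.{v₁, u₁, u}}
    {ψ : Hom 𝒢'' 𝒢'} {φ : Hom 𝒢' 𝒢} (hψ : ψ.IsFiniteEtaleCoveringGlobal)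
    (hφ : φ.IsFiniteEtaleCoveringGlobal) (h𝒢' : 𝒢'.IsConnected) (h𝒢 : 𝒢.IsConnected) :
    (ψ.comp φ).IsFiniteEtaleCoveringGlobal := by
  have hV : (ψ.comp φ).IsVertexAligned := Hom.IsFiniteEtaleCoveringGlobal.isVertexAligned_comp hψ hφ
  obtain ⟨B, hψl, hψg, hψb, -⟩ := hψ
  obtain ⟨A, hφl, hφg, hφb, hφv⟩ := hφ
  have hBr : (ψ.comp φ).IsBranchAligned := hψb.comp hφb
  obtain ⟨instG, α, hα, ⟨e⟩⟩ := (show _ from hφg)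
  letI := instG
  haveI := hα
  exact ⟨(α.inv.obj B).left,
    Hom.IsFiniteEtaleCoveringOf.comp_of_connected hψl hφl hφb hφv h𝒢' h𝒢 α e,
    Hom.IsGlobalCoveringOf.comp_explicit hψg α e, hBr, hV⟩

end SemiGraphOfAnabelioids

end Literature.AnabelianGeometry.SemiGraphs
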